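import Summits.BirchSwinnertonDyer.BirchSwinnertonDyer.Theorems.CMKolyvaginAtInertTwoRestrictionInjectiveAtTwoPow
import Literature.NumberTheory.EllipticCurves.HeegnerPointsKolyvaginPrimaryCebotarevFrobeniusProofs
import HarnessLib

/-!
# Route `CMKolyvaginAtInertTwo`, crux `CMKolyvaginExactAtInertTwo` (stmt-BirchSwinnertonDyer-24277):
# THE ČEBOTAREV LEAF OF THE KERNEL KOLYVAGIN MACHINE AT `p = 2`, LEVEL `2^M` — Kolyvagin primes
# of depth `M` (Gross form, `Frob(ℓ) = Frob(∞)` on `K(E[2^M])`) with PRESCRIBED values of finitely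
# many classes of `H¹(K, E[2^M])` at the Frobenius of `λ`

Seat `bsd-line-cmk2-p1` g7 (cell `bsd-print-cf2`); helper (`--supports stmt-BirchSwinnertonDyer-24277`).
THEOREMS ONLY: no definition, no named fact, no `sorry`; no item is closed; BSD is not proved by this.
Conditional on the Čebotarev density theorem (`Automorphic.chebotarev_artinRep`, a named fact of the
tree, discharged: `chebotarev_artinRep_holds`) exactly like the odd-`p` leaf, and on the level-`2^M`
Cartan-type hypothesis `hcomm` of `…RestrictionInjectiveAtTwoPow` (module docstring there).

WHAT. KERNEL-STATUS-p2-port.md (v5, §5b): "the LOCAL theory of the `p = 2` port is now complete at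
all levels; what remains for an `M₀ ≥ 1` `τ`-part is GLOBAL (level-`2^M` Čebotarev leaf at `2`)".
Seat g3 did the leaf at LEVEL `2` (`exists_kolyvaginPrime_gt_two`, p597930; with targets, p599084).
This file is the leaf at LEVEL `2^M`, in the most flexible shape (targets, signs, a permutation):

* `exists_kolyvaginPrime_gt_two_pow_of_targets` — `W/ℚ` with `ρ̄_{W,2}` onto, `K` imaginary
  quadratic with `Δ_W ∉ K²` and conjugation `c ≠ 1`, `c₀ ∈ Γ_ℚ` a complex conjugation (fixing the
  lift `τ = e c₀ e⁻¹`), `z ∈ Γ_K` of order-`3` type on `E[2]` commuting on `E[2^M]` with `Γ_{K(E[2])}`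
  (`hcomm`); classes `x_i ∈ H¹(K, E[2^M])` killed by `2^{eᵢ}`, independent
  (`∑ aᵢxᵢ = 0 ⟹ 2^{eᵢ} ∣ aᵢ`), closed under `σ_*` up to sign and permutation
  (`σ_* x_i = ν_i x_{ι i}`, `ν_i = ±1`: eigenclasses `ι = id`; a pair `(t, τt)` with `ν = 1`), and
  targets `t_i ∈ E[2^M][2^{eᵢ}]`. THEN for every `b` there is a prime `ℓ > b`, `ℓ ∤ 2 N d_K`, `(ℓ)`
  prime in `𝓞_K`, `Frob(ℓ) = Frob(∞)` in `Gal(K(E[2^M])/ℚ)` (`FrobEqFrobInfty W K (2^M) ℓ` — a Kolyvagin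
  prime of DEPTH `M` in Gross's form (3.2); the congruences `2^M ∣ ℓ+1, a_ℓ` follow), and an element
  `F ∈ Γ_{K(E[2^M])}` — an arithmetic Frobenius of `λ = (ℓ)` up to `Γ_{K(E[2^M])}`-conjugacy,
  `F = (ρm)^τ(ρm)` — with
  **`[x_i, F] = ν_i·τ(t_{ι i}) + t_i`** for all `i`, and **`x_λ = 0 ⟺ [x, F] = 0`** for every `x`
  in the span of the `x_i` (McCallum's (3)). So the caller controls the local vectors at `λ` of all
  classes in the span: e.g. for a `ν`-eigenclass `x` with target `t`, `x_λ ↔ ν τ t + t`.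
  PROOF. Step B = McCallum's (2) at level `2^M` for `p = 2` (`exists_h1Eval_eq_two_pow`, this seat):
  `ρ ∈ Γ_{K(E[2^M])}` with `[x_i, ρ] = t_i`; Steps C–G = the tree's level-general
  `exists_kolyvaginPrime_gt_of_galoisElement` (finite exceptional set, Čebotarev in `Γ_ℚ` for
  `c₀·res(ρ𝒩)`, inertness, the local criterion at `λ`); the value at `F = (ρm)^τ(ρm)`, `m ∈ 𝒩`, is
  `[x_i, (ρm)^τ] + [x_i, ρm] = τ[σ_* x_i, ρm] + t_i = ν_i τ t_{ι i} + t_i` (`IsLiftOfAut.h1Eval_conjAct`).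

HONEST FRAMING. This is realisability: Kolyvagin primes of depth `M` CAN be aimed at prescribed
localisations of finitely many classes of `H¹(K, E[2^M])` (both eigen-signs, every order). The
congruence-form primes of the route's items (`Zhang2014.IsKolyvaginPrime … 2 ℓ ∧ CMInert W ℓ`) are
implied at depth `1`; the converse "depth-`M` congruence form ⟹ Frobenius form" (KERNEL-STATUS §3
item 5, the bridge) is NOT addressed and not needed by a descent that produces its own primes. What no
choice of prime can do is unchanged (memo §1): a `τ`-invariant class of order `2` has `[x, F] ∈ {0,
2^{M−1}(P + τP)}` and pairs trivially with every eigen tame vector.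

References: [McCallumLMS1991] §3 Prop. 3.1, (2), (3), Cor. 3.2 (proofs, PDF pp. 279–280);
[GrossLMS1991] §3 (3.1)–(3.3), §9 Props. 9.3, 9.6; [TateGCFT1967] §2.4 (Čebotarev).
-/

-- single-conjunct summit: `Summit.BirchSwinnertonDyer.BirchSwinnertonDyer.…` repeats the name by design
set_option linter.dupNamespace false
set_option autoImplicit false

noncomputable section

open scoped Classical Pointwise
open WeierstrassCurve NumberField IsDedekindDomain Field
open Literature.NumberTheory.GaloisRepresentations Literature.NumberTheory.EllipticCurves

namespace Summit.BirchSwinnertonDyer.BirchSwinnertonDyer.Theorems.KolyvaginImageTwo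

/-- **McCallum's Cor. 3.2 / the Čebotarev leaf at `p = 2`, level `2^M`, with targets.** See the
module docstring. Hypotheses: Čebotarev; `ρ̄_{W,2}` onto; `K` imaginary quadratic with `Δ_W ∉ K²`,
`c ≠ 1`; a complex conjugation `c₀`; `M ≥ 1`; `z` without non-zero fixed point on `E[2]` commuting on
`E[2^M]` with `Γ_{K(E[2])}`; classes `x_i` killed by `2^{eᵢ}`, independent, with
`σ_* x_i = ν_i x_{ι i}` (any integers `ν_i`; `±1` in every use); targets `t_i` killed by `2^{eᵢ}`. Conclusion: a prime `ℓ > b` with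
`ℓ ∤ N`, `ℓ ∤ d_K`, `ℓ ≠ 2`, `(ℓ)` prime, `FrobEqFrobInfty W K (2^M) ℓ`, and `F ∈ Γ_{K(E[2^M])}` with
`[x_i, F] = ν_i τ t_{ι i} + t_i` and `x_λ = 0 ⟺ [x, F] = 0` on the span of the `x_i` at the place
`λ ∋ ℓ`. [cite: McCallumLMS1991, §3 Prop. 3.1, (2), (3), Cor. 3.2 (proofs)]
[cite: GrossLMS1991, §9 (Props. 9.3, 9.6 and the density argument)] -/
theorem exists_kolyvaginPrime_gt_two_pow_of_targets
    (hC : Literature.NumberTheory.Automorphic.chebotarev_artinRep)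
    {N : ℕ} [NeZero N] (W : WeierstrassCurve ℚ) [W.IsElliptic] {K : Type} [Field K] [NumberField K]
    (hK : IsImaginaryQuadratic K) (hρ : W.HasSurjectiveModNGaloisRep 2)
    (hΔK : ¬ IsSquare (W.baseChange K).Δ) {c : K ≃ₐ[ℚ] K} (hc : c ≠ 1)
    {c₀ : absoluteGaloisGroup ℚ} (hc₀ : IsComplexConjugation (Rat.castHom ℝ) c₀)
    {M : ℕ} (hM : 1 ≤ M) {z : absoluteGaloisGroup K}
    (hzfix : ∀ P : geomTorsion (W.baseChange K) ((2 : ℕ) : ℤ), z • P = P → P = 0)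
    (hcomm : ∀ π ∈ torsionFixing (W.baseChange K) ((2 : ℕ) : ℤ),
      ∀ P : geomTorsion (W.baseChange K) ((2 ^ M : ℕ) : ℤ), π • z • P = z • π • P)
    {r : ℕ} (cs : Fin r → galH1Torsion (W.baseChange K) ((2 ^ M : ℕ) : ℤ))
    (ι : Fin r → Fin r) (ν : Fin r → ℤ)
    (hτ : ∀ i, conjAct W c ((2 ^ M : ℕ) : ℤ) (cs i) = ν i • cs (ι i))
    (ex : Fin r → ℕ) (he : ∀ i, (((2 : ℕ) : ℤ) ^ ex i) • cs i = 0)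
    (hind : ∀ a : Fin r → ℤ, ∑ i, a i • cs i = 0 → ∀ i, (((2 : ℕ) : ℤ) ^ ex i) ∣ a i)
    (t : Fin r → geomTorsion (W.baseChange K) ((2 ^ M : ℕ) : ℤ))
    (htt : ∀ i, (((2 : ℕ) : ℤ) ^ ex i) • t i = 0) (b : ℕ) :
    ∃ ℓ : ℕ, b < ℓ ∧ ℓ.Prime ∧ ¬ ℓ ∣ N ∧ ¬ ((ℓ : ℤ) ∣ NumberField.discr K) ∧ ℓ ≠ 2 ∧
      (Ideal.span {(ℓ : 𝓞 K)}).IsPrime ∧ FrobEqFrobInfty W K (2 ^ M) ℓ ∧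
      ∃ F ∈ torsionFixing (W.baseChange K) ((2 ^ M : ℕ) : ℤ),
        (∀ i, h1Eval (W.baseChange K) ((2 ^ M : ℕ) : ℤ) (cs i) F =
          ν i • (RatClosure.isLiftOfAut_absGaloisTransport_of_isImaginaryQuadratic hK hc hc₀).torsionMap
              W ((2 ^ M : ℕ) : ℤ) (t (ι i)) + t i) ∧
        ∀ x ∈ AddSubgroup.closure (Set.range cs),
          ∀ v : HeightOneSpectrum (𝓞 K), (ℓ : 𝓞 K) ∈ v.asIdeal →
            (x ∈ (W.baseChange K).torsionLocalKer (v.adicCompletion K) ((2 ^ M : ℕ) : ℤ) ↔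
              h1Eval (W.baseChange K) ((2 ^ M : ℕ) : ℤ) x F = 0) := by
  classical
  haveI : Algebra.IsQuadraticExtension ℚ K := ⟨hK.1⟩
  haveI : IsTotallyComplex K := hK.2
  -- ### Step A: the involutive lift of `c` through the complex conjugation `c₀`
  have ht : IsLiftOfAut c (absGaloisTransport (K := ℚ) (L := K) c₀).toRingEquiv :=
    RatClosure.isLiftOfAut_absGaloisTransport_of_isImaginaryQuadratic hK hc hc₀
  have hinv : ∀ x, (absGaloisTransport (K := ℚ) (L := K) c₀).toRingEquiv
      ((absGaloisTransport (K := ℚ) (L := K) c₀).toRingEquiv x) = x := fun x ↦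
    RatClosure.absGaloisTransport_absGaloisTransport_of_sq_eq_one hc₀.sq_eq_one x
  -- ### Step B (p = 2, level 2^M): McCallum's (2) with the given targets
  obtain ⟨ρ, hρT, hρe⟩ := exists_h1Eval_eq_two_pow W K hK.1 hρ hΔK hM hzfix hcomm cs ex he hind t htt
  -- ### Steps C–G: the tree's level-general Čebotarev bookkeeping
  obtain ⟨ℓ, hbℓ, hℓ, hℓN, hℓD, hℓ2, hprime, hfrob, m, hm, hloc⟩ :=
    exists_kolyvaginPrime_gt_of_galoisElement hC (N := N) (W := W) hK Nat.prime_two (M := M) hc₀ ht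
      hinv cs hρT b
  have hρm : ρ * m ∈ torsionFixing (W.baseChange K) ((2 ^ M : ℕ) : ℤ) := mul_mem hρT hm.1
  have hρm' := ht.conjGalCMH_mem_torsionFixing W hinv _ hρm
  refine ⟨ℓ, hbℓ, hℓ, hℓN, hℓD, hℓ2, hprime, hfrob, ht.conjGalCMH (ρ * m) * (ρ * m),
    mul_mem hρm' hρm, fun i ↦ ?_, hloc⟩
  -- ### the value at `F = (ρm)^τ (ρm)`: `[x_i, (ρm)^τ] = τ [σ_* x_i, ρm] = ν_i τ t_{ι i}`
  have hconj : h1Eval (W.baseChange K) ((2 ^ M : ℕ) : ℤ) (cs i) (ht.conjGalCMH (ρ * m)) =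
      ν i • ht.torsionMap W ((2 ^ M : ℕ) : ℤ) (t (ι i)) := by
    have h := ht.h1Eval_conjAct W ((2 ^ M : ℕ) : ℤ) (cs i) hρm
    rw [hτ i, h1Eval_zsmul _ _ _ _ hρm, h1Eval_mul _ _ _ hρT, hρe (ι i), hm.2 (ι i), add_zero] at h
    -- `h : ν i • t (ι i) = τ [cs i, (ρm)^τ]`; apply the involution `τ`
    have h' := congrArg (ht.torsionMap W ((2 ^ M : ℕ) : ℤ)) h
    rw [ht.torsionMap_torsionMap W hinv, map_zsmul] at h'
    exact h'.symm
  rw [h1Eval_mul _ _ _ hρm', hconj, h1Eval_mul _ _ _ hρT, hρe i, hm.2 i, add_zero]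

end Summit.BirchSwinnertonDyer.BirchSwinnertonDyer.Theorems.KolyvaginImageTwo

end
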